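import Literature.AlgebraicGeometry.Resolution.CoefficientIdealRestriction
import Literature.AlgebraicGeometry.Resolution.RegularLocalRingsQuotient
import Literature.AlgebraicGeometry.Resolution.RsopMonomialIdeals
import HarnessLib

/-!
# Crux `PatchingRelPerfect` (stmt-ResolutionOfSingularities-16161), chain W5.2 — T6-E1b residual `LegalScopedDivisorReduction₃`,
# PHASE 2 closer (2b), spec D4: LIFTING REGULAR PARAMETERS FROM THE HOST — `(z, u₁, …, u_n)`

[OURS · L1 W5.2 · res-L1-w52-lead-1 g5, hand #3b; spec `L/res-L1-w52-lead-1/PHASE2-STEPB-SPEC.md` §D4 ORACLE PLAN, steps (i)/(ii)]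
Replaces the role of NO printed item; NOT a statement of the manuscript under review; fact-free.

For the host hypersurface `ι : X = V(D) ↪ E` at a point `x` (`D_{ιx} = (z)`, `z ∉ 𝔪²`, regular ambient stalk) and a part
`ū : Fin n → 𝒪_{X,x}` of a regular system of parameters of the host, ANY lifts `u` of the `ūᵢ` give a part `(z, u₁, …, u_n)` of a
regular system of parameters of `𝒪_{E,ιx}`, and `(z, u) = (ι^♯)⁻¹ (ū)` (`𝒪_{E,ιx}/(z,u) ≅ 𝒪_{X,x}/(ū)`, Matsumura 14.2).  With
`n = 1` this is the two-parameter ideal of a host curve (…DepthLegalCurveLift); with `n = 2` (the two branches `Γ, Γ′` of the trace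
divisor through `x`) it is the coordinate system `t = (z, u_p, u_q)` of L4 (…DepthLegalRspChoice).

AI-written; AI review is weaker than expert review.

## References
* H. Matsumura, *Commutative Ring Theory* (1986), Thm. 14.2. [Matsumura1987]
-/

-- `Summit.<Summit>.<Sub>.Theorems` with `Sub = Summit` (single-conjunct summit, D-0017)
set_option linter.dupNamespace false

noncomputable section

open CategoryTheory CategoryTheory.Limits AlgebraicGeometry TopologicalSpace IsLocalRing
open Literature.AlgebraicGeometry.Resolution Scheme.IdealSheafData

namespace Summit.ResolutionOfSingularities.ResolutionOfSingularities.Theorems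

universe u

namespace DepthLegal

/-- [OURS · L1 W5.2] **Lifting regular parameters from the host** (module docstring). [cite: Matsumura1987, Thm. 14.2] -/
theorem isRsopPart_cons_lift {E : Scheme.{u}} {D : E.IdealSheafData} (x : D.subscheme)
    [IsRegularLocalRing (E.presheaf.stalk (D.subschemeι x))] {z : E.presheaf.stalk (D.subschemeι x)}
    (hDx : stalkIdeal D (D.subschemeι x) = Ideal.span {z}) (hz2 : z ∉ maximalIdeal (E.presheaf.stalk (D.subschemeι x)) ^ 2)
    {n : ℕ} {ubar : Fin n → D.subscheme.presheaf.stalk x} (hub : IsRsopPart ubar)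
    (u : Fin n → E.presheaf.stalk (D.subschemeι x)) (hu : ∀ i, (D.subschemeι.stalkMap x).hom (u i) = ubar i) :
    IsRsopPart (Fin.cons z u : Fin (n + 1) → E.presheaf.stalk (D.subschemeι x)) ∧
      Ideal.span (Set.range (Fin.cons z u : Fin (n + 1) → E.presheaf.stalk (D.subschemeι x))) =
        (Ideal.span (Set.range ubar)).comap (D.subschemeι.stalkMap x).hom := by
  have hsurj : Function.Surjective (D.subschemeι.stalkMap x).hom := D.subschemeι.stalkMap_surjective x
  have hker : RingHom.ker (D.subschemeι.stalkMap x).hom = Ideal.span {z} := by rw [ker_stalkMap_subschemeι, hDx]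
  have hzm : z ∈ maximalIdeal (E.presheaf.stalk (D.subschemeι x)) :=
    (Ideal.span_singleton_le_iff_mem _).mp (hDx ▸ (mem_support_iff_stalkIdeal_le D _).mp (subschemeι_apply_mem_support D x))
  -- the host stalk and its dimension
  let e : (E.presheaf.stalk (D.subschemeι x) ⧸ Ideal.span {z}) ≃+* D.subscheme.presheaf.stalk x :=
    (Ideal.quotEquivOfEq hker.symm).trans (RingHom.quotientKerEquivOfSurjective hsurj)
  have hq := IsRegularLocalRing.quotient_span_singleton hzm hz2
  -- `(z, u) = φ⁻¹ (ū)`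
  have hmap : Ideal.map (D.subschemeι.stalkMap x).hom (Ideal.span (Set.range u)) = Ideal.span (Set.range ubar) := by
    rw [Ideal.map_span, ← Set.range_comp]
    congr 1
    exact congrArg Set.range (funext hu)
  have hI : Ideal.span (Set.range (Fin.cons z u : Fin (n + 1) → E.presheaf.stalk (D.subschemeι x))) =
      (Ideal.span (Set.range ubar)).comap (D.subschemeι.stalkMap x).hom := by
    rw [Fin.range_cons, Ideal.span_insert, ← hmap, Ideal.comap_map_of_surjective _ hsurj, ← RingHom.ker_eq_comap_bot, hker,
      sup_comm]
  refine ⟨?_, hI⟩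
  -- the quotient `𝒪_E/(z,u) ≅ 𝒪_X/(ū)` is regular of the right dimension
  have hψ : Function.Surjective ((Ideal.Quotient.mk (Ideal.span (Set.range ubar))).comp (D.subschemeι.stalkMap x).hom) :=
    Ideal.Quotient.mk_surjective.comp hsurj
  have hkerψ : RingHom.ker ((Ideal.Quotient.mk (Ideal.span (Set.range ubar))).comp (D.subschemeι.stalkMap x).hom) =
      Ideal.span (Set.range (Fin.cons z u : Fin (n + 1) → E.presheaf.stalk (D.subschemeι x))) := by
    rw [← RingHom.comap_ker, Ideal.mk_ker, hI]
  let e' : (E.presheaf.stalk (D.subschemeι x) ⧸ Ideal.span (Set.range (Fin.cons z u : Fin (n + 1) → _))) ≃+*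
      (D.subscheme.presheaf.stalk x ⧸ Ideal.span (Set.range ubar)) :=
    (Ideal.quotEquivOfEq hkerψ.symm).trans (RingHom.quotientKerEquivOfSurjective hψ)
  haveI : IsRegularLocalRing (E.presheaf.stalk (D.subschemeι x) ⧸ Ideal.span (Set.range (Fin.cons z u : Fin (n + 1) → _))) := by
    haveI := hub.isRegularLocalRing_quotient; exact IsRegularLocalRing.of_ringEquiv e'.symm
  have hwm : ∀ i, (Fin.cons z u : Fin (n + 1) → E.presheaf.stalk (D.subschemeι x)) i ∈
      maximalIdeal (E.presheaf.stalk (D.subschemeι x)) := by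
    intro i
    refine Fin.cases ?_ (fun j => ?_) i
    · simpa only [Fin.cons_zero] using hzm
    · simp only [Fin.cons_succ]
      by_contra hnot
      have hu' : IsUnit (u j) := by
        by_contra hnu
        exact hnot ((mem_maximalIdeal _).mpr hnu)
      exact (mem_maximalIdeal _).mp (hub.mem_maximalIdeal j) (hu j ▸ hu'.map _)
  have hdim : ringKrullDim (E.presheaf.stalk (D.subschemeι x) ⧸ Ideal.span (Set.range (Fin.cons z u : Fin (n + 1) → _))) +
      ((n + 1 : ℕ) : WithBot ℕ∞) ≤ ringKrullDim (E.presheaf.stalk (D.subschemeι x)) := by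
    rw [ringKrullDim_eq_of_ringEquiv e', ← hq.2, ringKrullDim_eq_of_ringEquiv e, ← hub.ringKrullDim_quotient_add, Nat.cast_succ,
      add_assoc]
  exact IsRsopPart.of_isRegularLocalRing_quotient hwm hdim

end DepthLegal

end Summit.ResolutionOfSingularities.ResolutionOfSingularities.Theorems
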